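import Literature.Barriers.CriticalPhenomena.RigorousRGSmallParameterFRDScaleBounds
import Literature.Barriers.CriticalPhenomena.RigorousRGSmallParameterFRDGradientBounds
import HarnessLib

/-!
# `RigorousRGSmallParameter` (Slade, Theorem 1.4.1): the scaling estimate for the discrete
# gradients `∇^a Γ_j` of the finite-range decomposition (BBS (3.12) / Slade (10.5), `|a| ≥ 0`)

Companion of `RigorousRGSmallParameterFRDScaleBounds.lean` (the case `a = 0`:
`FRD.abs_Gam_le`) and `RigorousRGSmallParameterFRDGradientBounds.lean` (BBS's lemma on
`∇^α w(t,x)`) in the proof architecture of the barrier `RigorousRGSmallParameter.lean`. Sources: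
R. Bauerschmidt, D. Brydges, G. Slade, *Introduction to a renormalisation group method*
(LNM 2242, 2019; arXiv:1907.05474), Ch. 3, Proposition "Covariance decomposition" (scaling
estimates `|∇^α C_{j;xy}| ≤ c ϑ_{j-1} f_d(L) L^{-(d-2+|α|₁)(j-1)}`) and its proof; G. Slade,
*Critical exponents for long-range `O(n)` models below the upper critical dimension*, Commun.
Math. Phys. 358 (2018) 343–436, §10.1: "By [BBS-brief], for any multi-index `a` and for any
`p ≥ 0` (as large as desired), we have (10.5)
`|∇^aΓ_{j;x,y}(s)| ≤ c_Γ (1/(2d+s)) (1 + sL^{2(j-1)}/(2d+s))^{-p} L^{-(j-1)(d-2+|a|)}`, where the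
constant `c_Γ` depends on `a, p`, is independent of `L` for `d > 2`, but contains a factor `log L`
for `d = 2` and a factor `L^{2-d}` for `d < 2`."

## What this file proves (everything; no definition and no named fact is introduced)

* `FRD.latGrad_add'` — additivity of `∇^l`.
* `FRD.latGrad_setIntegral_wKer_div` — `∇^l` commutes with the scale integrals:
  `∇^l_x∫_{(a,b]}w(t,x;s)dt/t = ∫_{(a,b]}∇^l_xw(t,x;s)dt/t` (and integrability), whence
  `FRD.latGrad_Gam` — `∇^lΓ_j(x) = ∫_{J_j}∇^lw(t,x)dt/t` (`j ≥ 2`) — and `FRD.latGrad_Gam_one`.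
* `FRD.setIntegral_latGrad_wKer_div_Ioc_of_le_one` — the special part:
  `∫_{(0,a]}∇^lw(t,x;s)dt/t = a(1/(2d+s))(Re𝓕F(0)/(2πc))∇^l𝟙_{x=0}` (`0 < a ≤ 1`).
* `FRD.abs_setIntegral_latGrad_wKer_div_Ioc_le` — the regular part:
  `|∫_{(a,b]}∇^lw dt/t| ≤ cϑ(a,s;p)∫_{(a,b]}t^{1-d-n}dt` (`a ≥ 1`).
* `FRD.Slade2017_display107_grad`, `FRD.Slade2017_display108_grad_le_one/_small_mass/_large_mass`
  — Slade (10.7)–(10.8) for `∇^a w` (the three regimes, uniformly in the mass; `t²` of the regime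
  `t < 1` corrected to `t` as for `a = 0`).
* **`FRD.abs_latGrad_Gam_le`** — **BBS (3.12) = Slade (10.5) for general `a`, PROVED** (explicit
  [Baue13a]/BBS construction, `τ`-integral `F_{d+n}(L) = ∫_{(½,½L]}τ^{1-d-n}dτ` explicit): for
  `d ≥ 1`, `n`, `p` there is `c` — independent of `L, s, j, x` and of the unit-step list `l` of
  length `n` — with `|∇^lΓ_j(x)(s)| ≤ c·F_{d+n}(L)·(1/(2d+s))(1+L^{2(j-1)}s/(2d+s))^{-p}·
  (L^{j-1})^{2-d-n}` for all `L ≥ 2`, `s > 0`, `j ≥ 1`, `x`.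
* `FRD.abs_latGrad_Gam_le_of_three_le` — for `d + n ≥ 3` the `τ`-integral is `≤ 2^{d+n-2}` uniformly in `L`,
  giving the printed `L`-independent constant.
-/

noncomputable section

namespace Literature.Barriers.CriticalPhenomena

open _root_.MeasureTheory Set Filter
open scoped _root_.Topology Real FourierTransform

namespace LongRangePhi4

namespace FRD

open Literature.Probability.LatticeModels

variable {d : ℕ}

/-! ### `∇^l` and the scale integrals -/

/-- Additivity: `∇^l(f+g) = ∇^lf + ∇^lg`. [folklore] -/
theorem latGrad_add' (l : List (Site d)) (f g : Site d → ℝ) :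
    latGrad l (fun y => f y + g y) = fun x => latGrad l f x + latGrad l g x := by
  induction l with
  | nil => rfl
  | cons e l ih =>
      funext x
      simp only [latGrad_cons]
      rw [ih]
      ring

/-- **`∇^l` commutes with the scale integral**: for `s > 0`, `0 ≤ a`,
`∇^l_x ∫_{(a,b]} w(t,x;s)dt/t = ∫_{(a,b]} ∇^l_x w(t,x;s)dt/t`, the integrand on the right being
integrable (a finite signed sum of translates of `t ↦ w(t,y;s)/t`). [folklore] -/
theorem latGrad_setIntegral_wKer_div {s : ℝ} (hs : 0 < s) {a : ℝ} (ha : 0 ≤ a) (b : ℝ)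
    (l : List (Site d)) (x : Site d) :
    IntegrableOn (fun t : ℝ => latGrad l (wKer d s t) x / t) (Ioc a b) ∧
      latGrad l (fun y => ∫ t in Ioc a b, wKer d s t y / t) x =
        ∫ t in Ioc a b, latGrad l (wKer d s t) x / t := by
  set F : Site d → ℝ → ℝ := fun y t => wKer d s t y / t with hF
  have hFi : ∀ y, Integrable (F y) ((volume : Measure ℝ).restrict (Ioc a b)) :=
    fun y => integrableOn_wKer_div_Ioc hs y ha
  obtain ⟨h1, h2⟩ := latGrad_integral hFi l
  have hpt : ∀ t : ℝ, latGrad l (fun y => F y t) x = latGrad l (wKer d s t) x / t := by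
    intro t
    have e : (fun y => F y t) = fun y => t⁻¹ * wKer d s t y := by
      funext y
      simp only [hF]
      rw [div_eq_inv_mul]
    rw [e, latGrad_const_mul, div_eq_inv_mul]
  refine ⟨(h1 x).congr (Eventually.of_forall hpt), ?_⟩
  rw [h2 x]
  exact integral_congr_ae (Eventually.of_forall hpt)

/-- **`∇^lΓ_j(x)(s) = ∫_{J_j} ∇^l_x w(t,x;s) dt/t`** for `j ≥ 2`, `J_j = (½L^{j-1},½L^j]`
(Slade (10.6), differentiated under the integral). [cite: Slade2017, §10.1 (display (10.6))] -/
theorem latGrad_Gam {L : ℝ} (hL : 0 ≤ L) {s : ℝ} (hs : 0 < s) {j : ℕ} (hj : 2 ≤ j)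
    (l : List (Site d)) (x : Site d) :
    latGrad l (Gam d L s j) x =
      ∫ t in Ioc (L ^ (j - 1) / 2) (L ^ j / 2), latGrad l (wKer d s t) x / t := by
  have hG : Gam d L s j = fun y => ∫ t in Ioc (L ^ (j - 1) / 2) (L ^ j / 2), wKer d s t y / t :=
    funext fun y => Slade2017_display106 L s hj y
  rw [hG]
  exact (latGrad_setIntegral_wKer_div hs (by positivity) _ l x).2

/-- **`∇^lΓ_1(x)(s) = ∫_{(b,½L]} ∇^l w dt/t + ∫_{(0,b]} ∇^l w dt/t`** for `0 ≤ b ≤ ½L`, `s > 0`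
(Slade (10.6) for `j = 1`, differentiated). [cite: Slade2017, §10.1 (display (10.6), j = 1)] -/
theorem latGrad_Gam_one {L b : ℝ} (hb0 : 0 ≤ b) (hb : b ≤ L / 2) {s : ℝ} (hs : 0 < s)
    (l : List (Site d)) (x : Site d) :
    latGrad l (Gam d L s 1) x = (∫ t in Ioc b (L / 2), latGrad l (wKer d s t) x / t) +
      ∫ t in Ioc 0 b, latGrad l (wKer d s t) x / t := by
  have hG : Gam d L s 1 = fun y => (∫ t in Ioc b (L / 2), wKer d s t y / t) +
      ∫ t in Ioc 0 b, wKer d s t y / t := funext fun y => Gam_one_eq_add hb0 hb hs y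
  rw [hG, latGrad_add']
  simp only
  rw [(latGrad_setIntegral_wKer_div hs hb0 _ l x).2, (latGrad_setIntegral_wKer_div hs le_rfl _ l x).2]

/-- **The special part, differentiated**: for `0 < a ≤ 1`,
`∫_{(0,a]} ∇^l_x w(t,x;s) dt/t = a · (1/(2d+s)) · (Re𝓕F(0)/(2πc)) · ∇^l𝟙_{x=0}` (from the exact
formula of the `w` lemma for `t < 1`). [cite: BauerschmidtBrydgesSlade2019RG, Ch. 3, "Proof of Proposition (Covariance decomposition)" (display C_{0;0x} = (1/(2d+m²))(f̂(0)/2π)1_{x=0}, with ∇^α applied)] -/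
theorem setIntegral_latGrad_wKer_div_Ioc_of_le_one (s : ℝ) {a : ℝ} (ha0 : 0 < a) (ha1 : a ≤ 1)
    (l : List (Site d)) (x : Site d) :
    ∫ t in Ioc 0 a, latGrad l (wKer d s t) x / t =
      a * (1 / (2 * d + s) * ((𝓕 (profile : ℝ → ℂ) 0).re / (2 * π * cProfile)) *
        latGrad l (fun y : Site d => if y = 0 then (1 : ℝ) else 0) x) := by
  rw [integral_Ioc_eq_integral_Ioo]
  have h : EqOn (fun t : ℝ => latGrad l (wKer d s t) x / t)
      (fun _ => 1 / (2 * d + s) * ((𝓕 (profile : ℝ → ℂ) 0).re / (2 * π * cProfile)) *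
        latGrad l (fun y : Site d => if y = 0 then (1 : ℝ) else 0) x) (Ioo 0 a) := by
    intro t ht
    have ht0 : (0 : ℝ) < t := ht.1
    have ht1 : t < 1 := lt_of_lt_of_le ht.2 ha1
    simp only
    rw [latGrad_wKer_eq_of_lt_one ht0 ht1 l]
    simp only
    rw [div_eq_iff ht0.ne']
    ring
  rw [setIntegral_congr_fun measurableSet_Ioo h, setIntegral_const, smul_eq_mul,
    Real.volume_real_Ioo_of_le ha0.le, sub_zero]

/-- **The regular part, differentiated**: for `1 ≤ a ≤ b`,
`|∫_{(a,b]} ∇^l w(t,x;s)dt/t| ≤ cϑ(a,s;p)∫_{(a,b]}t^{1-d-n}dt`, given the `w`-lemma bound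
`|∇^l w(t,x)| ≤ cϑ(t,s;p)t^{2-d-n}` (`ϑ(t,·) ≤ ϑ(a,·)` for `t ≥ a`).
[cite: BauerschmidtBrydgesSlade2019RG, Ch. 3, "Proof of Proposition (Covariance decomposition)" (the display bounding ∇^α∫w(t,x-y)dt/t)] -/
theorem abs_setIntegral_latGrad_wKer_div_Ioc_le {c : ℝ} {p n : ℕ} (hc : 0 ≤ c) {l : List (Site d)}
    (hw : ∀ s : ℝ, 0 < s → ∀ t : ℝ, 1 ≤ t → ∀ x : Site d,
      |latGrad l (wKer d s t) x| ≤
        c / (2 * d + s) * ((1 + t ^ 2 * s / (2 * d + s)) ^ p)⁻¹ * (t ^ 2 / t ^ (d + n)))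
    {s : ℝ} (hs : 0 < s) {a : ℝ} (ha : 1 ≤ a) (b : ℝ) (x : Site d) :
    |∫ t in Ioc a b, latGrad l (wKer d s t) x / t| ≤
      c / (2 * d + s) * ((1 + a ^ 2 * s / (2 * d + s)) ^ p)⁻¹ * ∫ t in Ioc a b, t / t ^ (d + n) := by
  have hM : 0 < 2 * (d : ℝ) + s := by positivity
  have ha0 : 0 < a := by linarith
  set K : ℝ := c / (2 * d + s) * ((1 + a ^ 2 * s / (2 * d + s)) ^ p)⁻¹ with hK
  have hint : IntegrableOn (fun t : ℝ => latGrad l (wKer d s t) x / t) (Ioc a b) :=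
    (latGrad_setIntegral_wKer_div hs ha0.le b l x).1
  have hg : IntegrableOn (fun t : ℝ => t / t ^ (d + n)) (Ioc a b) :=
    integrableOn_div_pow_Ioc (d := d + n) ha0
  calc |∫ t in Ioc a b, latGrad l (wKer d s t) x / t|
      ≤ ∫ t in Ioc a b, |latGrad l (wKer d s t) x / t| := abs_integral_le_integral_abs
    _ ≤ ∫ t in Ioc a b, K * (t / t ^ (d + n)) := by
        refine setIntegral_mono_on hint.abs (hg.const_mul K) measurableSet_Ioc fun t ht => ?_
        have ht1 : 1 ≤ t := ha.trans ht.1.le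
        have ht0 : 0 < t := by linarith
        have htd : 0 < t ^ (d + n) := by positivity
        rw [abs_div, abs_of_pos ht0, div_le_iff₀ ht0]
        have hθ : ((1 + t ^ 2 * s / (2 * d + s)) ^ p)⁻¹ ≤ ((1 + a ^ 2 * s / (2 * d + s)) ^ p)⁻¹ := by
          apply inv_anti₀ (by positivity)
          apply pow_le_pow_left₀ (by positivity)
          have h1 : a ^ 2 ≤ t ^ 2 := pow_le_pow_left₀ ha0.le ht.1.le 2
          have h2 : a ^ 2 * s / (2 * d + s) ≤ t ^ 2 * s / (2 * d + s) :=
            div_le_div_of_nonneg_right (mul_le_mul_of_nonneg_right h1 hs.le) hM.le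
          linarith
        calc |latGrad l (wKer d s t) x|
            ≤ c / (2 * d + s) * ((1 + t ^ 2 * s / (2 * d + s)) ^ p)⁻¹ * (t ^ 2 / t ^ (d + n)) :=
              hw s hs t ht1 x
          _ ≤ c / (2 * d + s) * ((1 + a ^ 2 * s / (2 * d + s)) ^ p)⁻¹ * (t ^ 2 / t ^ (d + n)) := by
              gcongr
          _ = K * (t / t ^ (d + n)) * t := by
              simp only [hK]
              ring
    _ = K * ∫ t in Ioc a b, t / t ^ (d + n) := integral_const_mul _ _

/-! ### Slade (10.7) and (10.8) with gradients -/

/-- **Slade, display (10.7), general `a`, PROVED in corrected form**: for `d ≥ 1`, `n` and every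
`p` there is `c₀` with `|∇^l w(t,x;s)| ≤ c₀ (1/(1+s)) (1+st²/(1+s))^{-p} (t ∧ t^{2-d-n})` for all
unit-step lists `l` of length `n`, `s > 0`, `t > 0`, `x` — Slade's "`|∇^a w(t,x;s)| ≤
c₀(1/(1+s))(1+st²/(1+s))^{-p}(t² ∧ t^{-(d-2+|a|)})`" with, as for `a = 0`
(`Slade2017_display107`), the printed `t²` of the regime `t < 1` replaced by `t` (the exact
formula of the `w` lemma is linear in `t`). [cite: Slade2017, §10.1 (display (10.7))] -/
theorem Slade2017_display107_grad (hd : 1 ≤ d) (n p : ℕ) :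
    ∃ c₀ : ℝ, 0 < c₀ ∧ ∀ l : List (Site d), l.length = n → (∀ e ∈ l, (∑ i, |((e i : ℤ) : ℝ)|) ≤ 1) →
      ∀ s : ℝ, 0 < s → ∀ t : ℝ, 0 < t → ∀ x : Site d,
      |latGrad l (wKer d s t) x| ≤
        c₀ * (1 + s)⁻¹ * ((1 + s * t ^ 2 / (1 + s)) ^ p)⁻¹ * min t (t ^ 2 / t ^ (d + n)) := by
  obtain ⟨c, hc, hwall⟩ := abs_latGrad_wKer_le_vartheta (d := d) n p
  set κ : ℝ := 2 ^ n * |(𝓕 (profile : ℝ → ℂ) 0).re / (2 * π * cProfile)| with hκ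
  have hκ0 : 0 ≤ κ := by positivity
  have hd' : (1 : ℝ) ≤ d := by exact_mod_cast hd
  refine ⟨c * (2 * d) ^ p + κ * 2 ^ p + 1, by positivity, fun l hl hl1 s hs t ht x => ?_⟩
  have hw := hwall l hl hl1
  have h1s : 0 < 1 + s := by linarith
  have hM : 0 < 2 * (d : ℝ) + s := by linarith
  set θ : ℝ := ((1 + s * t ^ 2 / (1 + s)) ^ p)⁻¹ with hθ
  have hθ0 : 0 < θ := by positivity
  have hMs : (2 * (d : ℝ) + s)⁻¹ ≤ (1 + s)⁻¹ := inv_anti₀ h1s (by linarith)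
  have htd : 0 < t ^ (d + n) := by positivity
  have hY : 0 ≤ (1 + s)⁻¹ * θ * min t (t ^ 2 / t ^ (d + n)) := by
    have : 0 ≤ min t (t ^ 2 / t ^ (d + n)) := le_min ht.le (by positivity)
    positivity
  rcases le_or_gt 1 t with ht1 | ht1
  · -- `t ≥ 1`: the `ϑ`-bound
    have hmin : min t (t ^ 2 / t ^ (d + n)) = t ^ 2 / t ^ (d + n) := by
      refine min_eq_right ?_
      rw [div_le_iff₀ htd, sq]
      exact mul_le_mul_of_nonneg_left (le_self_pow₀ ht1 (by omega)) ht.le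
    have h := hw s hs t ht1 x
    have hdec := inv_decay_le hd hs.le t p
    calc |latGrad l (wKer d s t) x|
        ≤ c / (2 * d + s) * ((1 + t ^ 2 * s / (2 * d + s)) ^ p)⁻¹ * (t ^ 2 / t ^ (d + n)) := h
      _ ≤ c * (1 + s)⁻¹ * ((2 * d : ℝ) ^ p * θ) * (t ^ 2 / t ^ (d + n)) := by
          rw [div_eq_mul_inv]
          gcongr
      _ = c * (2 * d) ^ p * ((1 + s)⁻¹ * θ * min t (t ^ 2 / t ^ (d + n))) := by rw [hmin]; ring
      _ ≤ (c * (2 * d) ^ p + κ * 2 ^ p + 1) * ((1 + s)⁻¹ * θ * min t (t ^ 2 / t ^ (d + n))) := by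
          apply mul_le_mul_of_nonneg_right _ hY
          linarith [mul_nonneg hκ0 (pow_nonneg zero_le_two p : (0 : ℝ) ≤ 2 ^ p)]
      _ = _ := by ring
  · -- `t < 1`: the exact formula
    have hmin : min t (t ^ 2 / t ^ (d + n)) = t := by
      refine min_eq_left ?_
      rw [le_div_iff₀ htd, sq]
      exact mul_le_mul_of_nonneg_left (pow_le_of_le_one ht.le ht1.le (by omega)) ht.le
    have h := (by have := abs_latGrad_wKer_le_of_lt_one hs ht ht1 l x; rwa [hl, ← hκ] at this)
    have hθ1 : 1 ≤ 2 ^ p * θ := by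
      have hle : 1 + s * t ^ 2 / (1 + s) ≤ 2 := by
        have : s * t ^ 2 / (1 + s) ≤ 1 := by
          rw [div_le_one h1s]
          nlinarith [sq_nonneg t, mul_le_mul_of_nonneg_left (show t ^ 2 ≤ 1 by nlinarith) hs.le]
        linarith
      have h1 : (1 + s * t ^ 2 / (1 + s)) ^ p ≤ 2 ^ p := pow_le_pow_left₀ (by positivity) hle p
      rw [hθ, ← div_eq_mul_inv, le_div_iff₀ (by positivity), one_mul]
      exact h1
    calc |latGrad l (wKer d s t) x| ≤ κ * (t / (2 * d + s)) := h
      _ ≤ κ * (t * (1 + s)⁻¹) := by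
          rw [div_eq_mul_inv]
          gcongr
      _ ≤ κ * (t * (1 + s)⁻¹) * (2 ^ p * θ) := le_mul_of_one_le_right (by positivity) hθ1
      _ = κ * 2 ^ p * ((1 + s)⁻¹ * θ * min t (t ^ 2 / t ^ (d + n))) := by rw [hmin]; ring
      _ ≤ (c * (2 * d) ^ p + κ * 2 ^ p + 1) * ((1 + s)⁻¹ * θ * min t (t ^ 2 / t ^ (d + n))) := by
          apply mul_le_mul_of_nonneg_right _ hY
          have : 0 ≤ c * (2 * d : ℝ) ^ p := by positivity
          linarith
      _ = _ := by ring

/-- **Slade, display (10.8), first regime (`t ≤ 1`), general `a`, PROVED in corrected form**: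
`|∇^l w(t,x;s)| ≤ c t/(1+s)` for `0 < t ≤ 1`, `s > 0` (printed with `t²`; see
`Slade2017_display107_grad`). [cite: Slade2017, §10.1 (display (10.8), case t ≤ 1)] -/
theorem Slade2017_display108_grad_le_one (hd : 1 ≤ d) (n : ℕ) :
    ∃ c : ℝ, 0 < c ∧ ∀ l : List (Site d), l.length = n → (∀ e ∈ l, (∑ i, |((e i : ℤ) : ℝ)|) ≤ 1) →
      ∀ s : ℝ, 0 < s → ∀ t : ℝ, 0 < t → t ≤ 1 → ∀ x : Site d,
      |latGrad l (wKer d s t) x| ≤ c * (t / (1 + s)) := by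
  obtain ⟨c, hc, hwall⟩ := abs_latGrad_wKer_le_vartheta (d := d) n 0
  set κ : ℝ := 2 ^ n * |(𝓕 (profile : ℝ → ℂ) 0).re / (2 * π * cProfile)| with hκ
  have hκ0 : 0 ≤ κ := by positivity
  have hd' : (1 : ℝ) ≤ d := by exact_mod_cast hd
  refine ⟨c + κ, by positivity, fun l hl hl1 s hs t ht0 ht1 x => ?_⟩
  have hw := hwall l hl hl1
  have h1s : 0 < 1 + s := by linarith
  have hM : 0 < 2 * (d : ℝ) + s := by linarith
  have hfrac : t / (2 * d + s) ≤ t / (1 + s) :=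
    div_le_div_of_nonneg_left ht0.le h1s (by linarith)
  have ht' : 0 ≤ t / (1 + s) := by positivity
  rcases ht1.lt_or_eq with hlt | heq
  · calc |latGrad l (wKer d s t) x| ≤ κ * (t / (2 * d + s)) := (by have := abs_latGrad_wKer_le_of_lt_one hs ht0 hlt l x; rwa [hl, ← hκ] at this)
      _ ≤ κ * (t / (1 + s)) := mul_le_mul_of_nonneg_left hfrac hκ0
      _ ≤ (c + κ) * (t / (1 + s)) := by
          apply mul_le_mul_of_nonneg_right _ ht'
          linarith
  · subst heq
    have h := hw s hs 1 le_rfl x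
    simp only [one_pow, pow_zero, inv_one, mul_one, div_one] at h
    calc |latGrad l (wKer d s 1) x| ≤ c / (2 * d + s) := h
      _ ≤ c * (1 / (1 + s)) := by
          rw [div_eq_mul_one_div]
          exact mul_le_mul_of_nonneg_left (by simpa using hfrac) hc.le
      _ ≤ (c + κ) * (1 / (1 + s)) := by
          apply mul_le_mul_of_nonneg_right _ (by positivity)
          linarith

/-- **Slade, display (10.8), second regime (`t ≥ ½`, `s ≤ 1`), general `a`, PROVED**:
`|∇^l w(t,x;s)| ≤ c (1+st²)^{-p} t^{2-d-n}`. [cite: Slade2017, §10.1 (display (10.8), case t ≥ ½, s ≤ 1)] -/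
theorem Slade2017_display108_grad_small_mass (hd : 1 ≤ d) (n p : ℕ) :
    ∃ c : ℝ, 0 < c ∧ ∀ l : List (Site d), l.length = n → (∀ e ∈ l, (∑ i, |((e i : ℤ) : ℝ)|) ≤ 1) →
      ∀ s : ℝ, 0 < s → s ≤ 1 → ∀ t : ℝ, 1 / 2 ≤ t → ∀ x : Site d,
      |latGrad l (wKer d s t) x| ≤ c * ((1 + s * t ^ 2) ^ p)⁻¹ * (t ^ 2 / t ^ (d + n)) := by
  obtain ⟨c, hc, hwall⟩ := abs_latGrad_wKer_le_vartheta (d := d) n p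
  set κ : ℝ := 2 ^ n * |(𝓕 (profile : ℝ → ℂ) 0).re / (2 * π * cProfile)| with hκ
  have hκ0 : 0 ≤ κ := by positivity
  have hd' : (1 : ℝ) ≤ d := by exact_mod_cast hd
  refine ⟨c * (2 * d + 1) ^ p + 4 * 2 ^ p * κ, by positivity, fun l hl hl1 s hs hs1 t ht x => ?_⟩
  have hw := hwall l hl hl1
  have hM : 0 < 2 * (d : ℝ) + s := by linarith
  have hM1 : 1 ≤ 2 * (d : ℝ) + s := by linarith
  have ht0 : 0 < t := by linarith
  have htd : 0 < t ^ (d + n) := by positivity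
  set θ : ℝ := ((1 + s * t ^ 2) ^ p)⁻¹ with hθ
  have hθ0 : 0 < θ := by positivity
  have hY : 0 ≤ θ * (t ^ 2 / t ^ (d + n)) := by positivity
  rcases le_or_gt 1 t with ht1 | ht1
  · have h := hw s hs t ht1 x
    -- `1 + st² ≤ (2d+1)(1 + t²s/(2d+s))`
    have hcmp : ((1 + t ^ 2 * s / (2 * d + s)) ^ p)⁻¹ ≤ (2 * d + 1 : ℝ) ^ p * θ := by
      have hS : 0 < 1 + s * t ^ 2 := by positivity
      have hle : 1 + s * t ^ 2 ≤ (2 * d + 1) * (1 + t ^ 2 * s / (2 * d + s)) := by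
        have h1 : s * t ^ 2 ≤ (2 * d + 1) * (t ^ 2 * s / (2 * d + s)) := by
          rw [mul_div_assoc', le_div_iff₀ hM]
          nlinarith [mul_nonneg hs.le (sq_nonneg t)]
        nlinarith [div_nonneg (mul_nonneg (sq_nonneg t) hs.le) hM.le]
      have h1 : (1 + s * t ^ 2) ^ p ≤ (2 * d + 1 : ℝ) ^ p * (1 + t ^ 2 * s / (2 * d + s)) ^ p := by
        rw [← mul_pow]
        exact pow_le_pow_left₀ hS.le hle p
      have h2 := inv_anti₀ (pow_pos hS p) h1
      calc ((1 + t ^ 2 * s / (2 * d + s)) ^ p)⁻¹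
          = (2 * d + 1 : ℝ) ^ p *
              ((2 * d + 1 : ℝ) ^ p * (1 + t ^ 2 * s / (2 * d + s)) ^ p)⁻¹ := by
            have : (2 * d + 1 : ℝ) ^ p ≠ 0 := by positivity
            field_simp
        _ ≤ (2 * d + 1 : ℝ) ^ p * θ := mul_le_mul_of_nonneg_left h2 (by positivity)
    have hc1 : c / (2 * d + s) ≤ c := div_le_self hc.le hM1
    calc |latGrad l (wKer d s t) x|
        ≤ c / (2 * d + s) * ((1 + t ^ 2 * s / (2 * d + s)) ^ p)⁻¹ * (t ^ 2 / t ^ (d + n)) := h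
      _ ≤ c * ((2 * d + 1 : ℝ) ^ p * θ) * (t ^ 2 / t ^ (d + n)) := by gcongr
      _ = c * (2 * d + 1) ^ p * (θ * (t ^ 2 / t ^ (d + n))) := by ring
      _ ≤ (c * (2 * d + 1) ^ p + 4 * 2 ^ p * κ) * (θ * (t ^ 2 / t ^ (d + n))) := by
          apply mul_le_mul_of_nonneg_right _ hY
          have : 0 ≤ 4 * 2 ^ p * κ := by positivity
          linarith
      _ = _ := by ring
  · have h := (by have := abs_latGrad_wKer_le_of_lt_one hs ht0 ht1 l x; rwa [hl, ← hκ] at this)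
    have hq := quarter_le_sq_div_pow (d := d + n) ht ht1.le
    have hθ1 : 1 ≤ 2 ^ p * θ := by
      have hle : 1 + s * t ^ 2 ≤ 2 := by nlinarith [mul_le_mul_of_nonneg_left (show t ^ 2 ≤ 1 by nlinarith) hs.le]
      have h1 : (1 + s * t ^ 2) ^ p ≤ 2 ^ p := pow_le_pow_left₀ (by positivity) hle p
      rw [hθ, ← div_eq_mul_inv, le_div_iff₀ (by positivity), one_mul]
      exact h1
    have hts : t / (2 * d + s) ≤ 1 := by
      rw [div_le_one hM]
      linarith
    calc |latGrad l (wKer d s t) x| ≤ κ * (t / (2 * d + s)) := h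
      _ ≤ κ * 1 := mul_le_mul_of_nonneg_left hts hκ0
      _ ≤ κ * 1 * (2 ^ p * θ) * (4 * (t ^ 2 / t ^ (d + n))) := by
          have h1 : κ * 1 ≤ κ * 1 * (2 ^ p * θ) := le_mul_of_one_le_right (by positivity) hθ1
          have h2 : (1 : ℝ) ≤ 4 * (t ^ 2 / t ^ (d + n)) := by linarith
          exact h1.trans (le_mul_of_one_le_right (by positivity) h2)
      _ = 4 * 2 ^ p * κ * (θ * (t ^ 2 / t ^ (d + n))) := by ring
      _ ≤ (c * (2 * d + 1) ^ p + 4 * 2 ^ p * κ) * (θ * (t ^ 2 / t ^ (d + n))) := by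
          apply mul_le_mul_of_nonneg_right _ hY
          have : 0 ≤ c * (2 * d + 1 : ℝ) ^ p := by positivity
          linarith
      _ = _ := by ring

/-- **Slade, display (10.8), third regime (`t ≥ ½`, `s ≥ 1`), general `a`, PROVED**:
`|∇^l w(t,x;s)| ≤ c s⁻¹ t^{-2p} t^{2-d-n}`. [cite: Slade2017, §10.1 (display (10.8), case t ≥ ½, s ≥ 1)] -/
theorem Slade2017_display108_grad_large_mass (hd : 1 ≤ d) (n p : ℕ) :
    ∃ c : ℝ, 0 < c ∧ ∀ l : List (Site d), l.length = n → (∀ e ∈ l, (∑ i, |((e i : ℤ) : ℝ)|) ≤ 1) →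
      ∀ s : ℝ, 1 ≤ s → ∀ t : ℝ, 1 / 2 ≤ t → ∀ x : Site d,
      |latGrad l (wKer d s t) x| ≤ c * s⁻¹ * (t ^ (2 * p))⁻¹ * (t ^ 2 / t ^ (d + n)) := by
  obtain ⟨c, hc, hwall⟩ := abs_latGrad_wKer_le_vartheta (d := d) n p
  set κ : ℝ := 2 ^ n * |(𝓕 (profile : ℝ → ℂ) 0).re / (2 * π * cProfile)| with hκ
  have hκ0 : 0 ≤ κ := by positivity
  have hd' : (1 : ℝ) ≤ d := by exact_mod_cast hd
  refine ⟨c * (2 * d + 1) ^ p + 4 * 2 ^ (2 * p) * κ, by positivity, fun l hl hl1 s hs1 t ht x => ?_⟩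
  have hw := hwall l hl hl1
  have hs : 0 < s := by linarith
  have hM : 0 < 2 * (d : ℝ) + s := by linarith
  have ht0 : 0 < t := by linarith
  have htd : 0 < t ^ (d + n) := by positivity
  have ht2p : 0 < t ^ (2 * p) := by positivity
  have hY : 0 ≤ s⁻¹ * (t ^ (2 * p))⁻¹ * (t ^ 2 / t ^ (d + n)) := by positivity
  have hMs : (2 * (d : ℝ) + s)⁻¹ ≤ s⁻¹ := inv_anti₀ hs (by linarith)
  rcases le_or_gt 1 t with ht1 | ht1
  · have h := hw s hs t ht1 x
    -- `1 + t²s/(2d+s) ≥ t²/(2d+1)`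
    have hsM : t ^ 2 / (2 * d + 1) ≤ 1 + t ^ 2 * s / (2 * d + s) := by
      have h1 : t ^ 2 / (2 * d + 1) ≤ t ^ 2 * s / (2 * d + s) := by
        rw [div_le_div_iff₀ (by positivity) hM]
        have : 2 * (d : ℝ) + s ≤ s * (2 * d + 1) := by nlinarith
        nlinarith [sq_nonneg t]
      have : 0 ≤ t ^ 2 * s / (2 * d + s) := by positivity
      linarith
    have hcmp : ((1 + t ^ 2 * s / (2 * d + s)) ^ p)⁻¹ ≤ (2 * d + 1 : ℝ) ^ p * (t ^ (2 * p))⁻¹ := by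
      rw [pow_mul, ← div_eq_mul_inv, ← div_pow, ← inv_pow]
      apply pow_le_pow_left₀ (by positivity)
      rw [inv_le_comm₀ (by positivity) (by positivity), inv_div]
      exact hsM
    calc |latGrad l (wKer d s t) x|
        ≤ c / (2 * d + s) * ((1 + t ^ 2 * s / (2 * d + s)) ^ p)⁻¹ * (t ^ 2 / t ^ (d + n)) := h
      _ ≤ c * s⁻¹ * ((2 * d + 1 : ℝ) ^ p * (t ^ (2 * p))⁻¹) * (t ^ 2 / t ^ (d + n)) := by
          rw [div_eq_mul_inv]
          gcongr
      _ = c * (2 * d + 1) ^ p * (s⁻¹ * (t ^ (2 * p))⁻¹ * (t ^ 2 / t ^ (d + n))) := by ring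
      _ ≤ (c * (2 * d + 1) ^ p + 4 * 2 ^ (2 * p) * κ) *
            (s⁻¹ * (t ^ (2 * p))⁻¹ * (t ^ 2 / t ^ (d + n))) := by
          apply mul_le_mul_of_nonneg_right _ hY
          have : 0 ≤ 4 * 2 ^ (2 * p) * κ := by positivity
          linarith
      _ = _ := by ring
  · have h := (by have := abs_latGrad_wKer_le_of_lt_one hs ht0 ht1 l x; rwa [hl, ← hκ] at this)
    have hq := quarter_le_sq_div_pow (d := d + n) ht ht1.le
    -- `(t^{2p})⁻¹ ≥ 1` and indeed `2^{2p} (t^{2p})⁻¹ ≥ 1` suffices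
    have hT : 1 ≤ 2 ^ (2 * p) * (t ^ (2 * p))⁻¹ := by
      rw [← div_eq_mul_inv, le_div_iff₀ ht2p, one_mul]
      exact (pow_le_one₀ ht0.le ht1.le).trans (one_le_pow₀ (by norm_num))
    calc |latGrad l (wKer d s t) x| ≤ κ * (t / (2 * d + s)) := h
      _ ≤ κ * s⁻¹ := by
          refine mul_le_mul_of_nonneg_left ?_ hκ0
          rw [div_eq_mul_inv]
          calc t * (2 * d + s)⁻¹ ≤ 1 * (2 * d + s)⁻¹ := by gcongr
            _ ≤ s⁻¹ := by rw [one_mul]; exact hMs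
      _ ≤ κ * s⁻¹ * (2 ^ (2 * p) * (t ^ (2 * p))⁻¹) * (4 * (t ^ 2 / t ^ (d + n))) := by
          have h1 : κ * s⁻¹ ≤ κ * s⁻¹ * (2 ^ (2 * p) * (t ^ (2 * p))⁻¹) :=
            le_mul_of_one_le_right (by positivity) hT
          have h2 : (1 : ℝ) ≤ 4 * (t ^ 2 / t ^ (d + n)) := by linarith
          exact h1.trans (le_mul_of_one_le_right (by positivity) h2)
      _ = 4 * 2 ^ (2 * p) * κ * (s⁻¹ * (t ^ (2 * p))⁻¹ * (t ^ 2 / t ^ (d + n))) := by ring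
      _ ≤ (c * (2 * d + 1) ^ p + 4 * 2 ^ (2 * p) * κ) *
            (s⁻¹ * (t ^ (2 * p))⁻¹ * (t ^ 2 / t ^ (d + n))) := by
          apply mul_le_mul_of_nonneg_right _ hY
          have : 0 ≤ c * (2 * d + 1 : ℝ) ^ p := by positivity
          linarith
      _ = _ := by ring

/-! ### The scaling estimate BBS (3.12) / Slade (10.5), general `a` -/

/-- **BBS Proposition "Covariance decomposition", scaling estimate (3.12) for general `α` = Slade
(10.5) for general `a`, PROVED** (for the explicit [Baue13a]/BBS construction, with the
`τ`-integral `F_{d+n}(L) = ∫_{(½,½L]}τ^{1-d-n}dτ` left explicit): for `d ≥ 1`, `n` and every `p`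
there is `c` — independent of `L`, `s`, `j`, `x` and of the list `l` of `n` unit steps — with
`|∇^lΓ_j(x)(s)| ≤ c · F_{d+n}(L) · (1/(2d+s))(1+L^{2(j-1)}s/(2d+s))^{-p} · (L^{j-1})^{2-d-n}` for
all `L ≥ 2`, `s > 0`, `j ≥ 1`, `x`, i.e. Slade's
"`|∇^aΓ_{j;x,y}(s)| ≤ c_Γ(1/(2d+s))(1+sL^{2(j-1)}/(2d+s))^{-p}L^{-(j-1)(d-2+|a|)}`". Printed proof
(BBS), followed: for `j ≥ 2`, `|∫_{J_j}∇^αw dt/t| ≤ c∫ϑ(t,s;p)t^{-(d-2+|α|)}dt/t ≤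
c'ϑ_{j-1}L^{-(j-1)(d-2+|α|)}∫_{½}^{½L}τ^{1-d-|α|}dτ`; for `j = 1` the same on `[1,½L]` plus the
special part `∇^αC_{0;0x} = (1/(2d+s))(f̂(0)/2πc)∇^α𝟙_{x=0}`, `|∇^α𝟙_{x=0}| ≤ 2^{|α|}`.
[cite: BauerschmidtBrydgesSlade2019RG, Ch. 3, Proposition "Covariance decomposition" (scaling estimates with ∇^α) and its proof] [cite: Slade2017, §10.1 (display (10.5))] -/
theorem abs_latGrad_Gam_le (hd : 1 ≤ d) (n p : ℕ) :
    ∃ c : ℝ, 0 < c ∧ ∀ l : List (Site d), l.length = n → (∀ e ∈ l, (∑ i, |((e i : ℤ) : ℝ)|) ≤ 1) →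
      ∀ L : ℝ, 2 ≤ L → ∀ s : ℝ, 0 < s → ∀ j : ℕ, 1 ≤ j → ∀ x : Site d,
      |latGrad l (Gam d L s j) x| ≤ c * (∫ τ in Ioc (1 / 2 : ℝ) (L / 2), τ / τ ^ (d + n)) *
        (1 / (2 * d + s) * ((1 + (L ^ (j - 1)) ^ 2 * s / (2 * d + s)) ^ p)⁻¹) *
          ((L ^ (j - 1)) ^ 2 / (L ^ (j - 1)) ^ (d + n)) := by
  obtain ⟨c, hc, hwall⟩ := abs_latGrad_wKer_le_vartheta (d := d) n p
  set κ : ℝ := |(𝓕 (profile : ℝ → ℂ) 0).re / (2 * π * cProfile)| with hκ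
  have hκ0 : 0 ≤ κ := abs_nonneg _
  refine ⟨4 ^ p * c + 2 ^ (p + 1) * 2 ^ n * κ + 1, by positivity,
    fun l hl hl1 L hL s hs j hj x => ?_⟩
  have hw := hwall l hl hl1
  have hM : 0 < 2 * (d : ℝ) + s := by positivity
  set F : ℝ := ∫ τ in Ioc (1 / 2 : ℝ) (L / 2), τ / τ ^ (d + n) with hFdef
  have hF : 1 / 2 ≤ F := half_le_scaleIntegral (d := d + n) (by omega) hL
  have hF0 : 0 < F := by linarith
  set ℓ : ℝ := L ^ (j - 1) with hℓ
  have hℓ1 : 1 ≤ ℓ := one_le_pow₀ (by linarith)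
  have hℓ0 : 0 < ℓ := by linarith
  set ϑ : ℝ := 1 / (2 * d + s) * ((1 + ℓ ^ 2 * s / (2 * d + s)) ^ p)⁻¹ with hϑ
  have hϑ0 : 0 < ϑ := by positivity
  have hY : 0 ≤ F * ϑ * (ℓ ^ 2 / ℓ ^ (d + n)) := by positivity
  have hfin : ∀ {K : ℝ}, K ≤ 4 ^ p * c + 2 ^ (p + 1) * 2 ^ n * κ + 1 →
      |latGrad l (Gam d L s j) x| ≤ K * (F * ϑ * (ℓ ^ 2 / ℓ ^ (d + n))) →
      |latGrad l (Gam d L s j) x| ≤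
        (4 ^ p * c + 2 ^ (p + 1) * 2 ^ n * κ + 1) * F * ϑ * (ℓ ^ 2 / ℓ ^ (d + n)) := by
    intro K hK h
    calc |latGrad l (Gam d L s j) x| ≤ K * (F * ϑ * (ℓ ^ 2 / ℓ ^ (d + n))) := h
      _ ≤ (4 ^ p * c + 2 ^ (p + 1) * 2 ^ n * κ + 1) * (F * ϑ * (ℓ ^ 2 / ℓ ^ (d + n))) :=
          mul_le_mul_of_nonneg_right hK hY
      _ = _ := by ring
  rcases Nat.lt_or_ge j 2 with hj1 | hj2
  · -- `j = 1`: `∇Γ_1 = ∫_{(1,½L]} ∇w dt/t + ∇C_0`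
    have hj' : j = 1 := by omega
    subst hj'
    have hℓ' : ℓ = 1 := by simp [hℓ]
    have hsplit := latGrad_Gam_one (d := d) zero_le_one (by linarith : (1 : ℝ) ≤ L / 2) hs l x
    have hA := abs_setIntegral_latGrad_wKer_div_Ioc_le hc.le hw hs le_rfl (L / 2) x
    -- the regular part
    have hsub : Ioc (1 : ℝ) (L / 2) ⊆ Ioc (1 / 2) (L / 2) := Ioc_subset_Ioc (by norm_num) le_rfl
    have hnn : 0 ≤ᵐ[volume.restrict (Ioc (1 / 2 : ℝ) (L / 2))] fun τ : ℝ => τ / τ ^ (d + n) := by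
      refine (ae_restrict_iff' measurableSet_Ioc).2 (Eventually.of_forall fun τ hτ => ?_)
      have : (0 : ℝ) < τ := by linarith [hτ.1]
      positivity
    have hIF : ∫ t in Ioc (1 : ℝ) (L / 2), t / t ^ (d + n) ≤ F :=
      setIntegral_mono_set (integrableOn_div_pow_Ioc (d := d + n) (by norm_num)) hnn
        hsub.eventuallyLE
    have hA' : |∫ t in Ioc 1 (L / 2), latGrad l (wKer d s t) x / t| ≤
        c * (F * ϑ * (ℓ ^ 2 / ℓ ^ (d + n))) := by
      rw [hℓ'] at hϑ
      calc |∫ t in Ioc 1 (L / 2), latGrad l (wKer d s t) x / t|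
          ≤ c / (2 * d + s) * ((1 + 1 ^ 2 * s / (2 * d + s)) ^ p)⁻¹ *
              ∫ t in Ioc (1 : ℝ) (L / 2), t / t ^ (d + n) := hA
        _ ≤ c / (2 * d + s) * ((1 + 1 ^ 2 * s / (2 * d + s)) ^ p)⁻¹ * F := by gcongr
        _ = c * (F * ϑ * (ℓ ^ 2 / ℓ ^ (d + n))) := by
            rw [hϑ, hℓ']
            ring
    -- the special part `∇C_0`
    have hB : |∫ t in Ioc 0 1, latGrad l (wKer d s t) x / t| ≤
        2 ^ (p + 1) * 2 ^ n * κ * (F * ϑ * (ℓ ^ 2 / ℓ ^ (d + n))) := by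
      rw [setIntegral_latGrad_wKer_div_Ioc_of_le_one s zero_lt_one le_rfl l x, one_mul, abs_mul,
        abs_mul, abs_of_pos (by positivity : (0 : ℝ) < 1 / (2 * d + s)), ← hκ]
      have hδ : ∀ y : Site d, |(if y = 0 then (1 : ℝ) else 0)| ≤ 1 := by
        intro y
        split_ifs <;> simp
      have hG : |latGrad l (fun y : Site d => if y = 0 then (1 : ℝ) else 0) x| ≤ 2 ^ n * 1 := by
        have := abs_latGrad_le l hδ x
        rwa [hl] at this
      have hθ1 : 1 ≤ 2 ^ p * ((1 + ℓ ^ 2 * s / (2 * d + s)) ^ p)⁻¹ := by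
        rw [hℓ', one_pow, one_mul, ← div_eq_mul_inv, le_div_iff₀ (by positivity), one_mul]
        apply pow_le_pow_left₀ (by positivity)
        have : s / (2 * d + s) ≤ 1 := by
          rw [div_le_one hM]
          linarith [show (0 : ℝ) ≤ d from Nat.cast_nonneg d]
        linarith
      calc 1 / (2 * d + s) * κ * |latGrad l (fun y : Site d => if y = 0 then (1 : ℝ) else 0) x|
          ≤ 1 / (2 * d + s) * κ * (2 ^ n * 1) := by gcongr
        _ ≤ 1 / (2 * d + s) * κ * (2 ^ n * 1) * (2 ^ p * ((1 + ℓ ^ 2 * s / (2 * d + s)) ^ p)⁻¹) *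
              (2 * F) := by
            have h1 : 1 / (2 * d + s) * κ * (2 ^ n * 1) ≤
                1 / (2 * d + s) * κ * (2 ^ n * 1) *
                  (2 ^ p * ((1 + ℓ ^ 2 * s / (2 * d + s)) ^ p)⁻¹) :=
              le_mul_of_one_le_right (by positivity) hθ1
            exact h1.trans (le_mul_of_one_le_right (by positivity) (by linarith))
        _ = 2 ^ (p + 1) * 2 ^ n * κ * (F * ϑ * (ℓ ^ 2 / ℓ ^ (d + n))) := by
            rw [hϑ, hℓ', pow_succ]
            ring
    have hc4 : c ≤ 4 ^ p * c := le_mul_of_one_le_left hc.le (one_le_pow₀ (by norm_num))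
    refine hfin (K := c + 2 ^ (p + 1) * 2 ^ n * κ) (by linarith) ?_
    rw [hsplit]
    calc |(∫ t in Ioc 1 (L / 2), latGrad l (wKer d s t) x / t) +
          ∫ t in Ioc 0 1, latGrad l (wKer d s t) x / t|
        ≤ |∫ t in Ioc 1 (L / 2), latGrad l (wKer d s t) x / t| +
            |∫ t in Ioc 0 1, latGrad l (wKer d s t) x / t| := abs_add_le _ _
      _ ≤ c * (F * ϑ * (ℓ ^ 2 / ℓ ^ (d + n))) +
            2 ^ (p + 1) * 2 ^ n * κ * (F * ϑ * (ℓ ^ 2 / ℓ ^ (d + n))) := add_le_add hA' hB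
      _ = (c + 2 ^ (p + 1) * 2 ^ n * κ) * (F * ϑ * (ℓ ^ 2 / ℓ ^ (d + n))) := by ring
  · -- `j ≥ 2`
    have hℓ2 : 2 ≤ ℓ := by
      calc (2 : ℝ) ≤ L := hL
        _ ≤ L ^ (j - 1) := le_self_pow₀ (by linarith) (by omega)
    have ha : 1 ≤ ℓ / 2 := by linarith
    have hLj : L ^ j / 2 = ℓ * L / 2 := by
      rw [hℓ, ← pow_succ, Nat.sub_add_cancel hj]
    have hG : latGrad l (Gam d L s j) x =
        ∫ t in Ioc (ℓ / 2) (ℓ * L / 2), latGrad l (wKer d s t) x / t := by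
      rw [latGrad_Gam (by linarith : (0 : ℝ) ≤ L) hs hj2 l x, ← hℓ, hLj]
    have hA := abs_setIntegral_latGrad_wKer_div_Ioc_le hc.le hw hs ha (ℓ * L / 2) x
    have hscale := setIntegral_div_pow_Ioc_scale (d := d + n) hℓ0 (by linarith : (1 : ℝ) ≤ L)
    have hθ4 : ((1 + (ℓ / 2) ^ 2 * s / (2 * d + s)) ^ p)⁻¹ ≤
        4 ^ p * ((1 + ℓ ^ 2 * s / (2 * d + s)) ^ p)⁻¹ := by
      have hS : 0 < 1 + ℓ ^ 2 * s / (2 * d + s) := by positivity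
      have hle : 1 + ℓ ^ 2 * s / (2 * d + s) ≤ 4 * (1 + (ℓ / 2) ^ 2 * s / (2 * d + s)) := by
        have : 4 * ((ℓ / 2) ^ 2 * s / (2 * d + s)) = ℓ ^ 2 * s / (2 * d + s) := by ring
        linarith
      have h1 : (1 + ℓ ^ 2 * s / (2 * d + s)) ^ p ≤
          (4 : ℝ) ^ p * (1 + (ℓ / 2) ^ 2 * s / (2 * d + s)) ^ p := by
        rw [← mul_pow]
        exact pow_le_pow_left₀ hS.le hle p
      have h2 := inv_anti₀ (pow_pos hS p) h1
      calc ((1 + (ℓ / 2) ^ 2 * s / (2 * d + s)) ^ p)⁻¹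
          = (4 : ℝ) ^ p * ((4 : ℝ) ^ p * (1 + (ℓ / 2) ^ 2 * s / (2 * d + s)) ^ p)⁻¹ := by
            have : (4 : ℝ) ^ p ≠ 0 := by positivity
            field_simp
        _ ≤ 4 ^ p * ((1 + ℓ ^ 2 * s / (2 * d + s)) ^ p)⁻¹ :=
            mul_le_mul_of_nonneg_left h2 (by positivity)
    have h2κ : 0 ≤ 2 ^ (p + 1) * 2 ^ n * κ := by positivity
    refine hfin (K := 4 ^ p * c) (by linarith) ?_
    rw [hG]
    calc |∫ t in Ioc (ℓ / 2) (ℓ * L / 2), latGrad l (wKer d s t) x / t|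
        ≤ c / (2 * d + s) * ((1 + (ℓ / 2) ^ 2 * s / (2 * d + s)) ^ p)⁻¹ *
            ∫ t in Ioc (ℓ / 2) (ℓ * L / 2), t / t ^ (d + n) := hA
      _ = c / (2 * d + s) * ((1 + (ℓ / 2) ^ 2 * s / (2 * d + s)) ^ p)⁻¹ *
            (ℓ ^ 2 / ℓ ^ (d + n) * F) := by rw [hscale]
      _ ≤ c / (2 * d + s) * (4 ^ p * ((1 + ℓ ^ 2 * s / (2 * d + s)) ^ p)⁻¹) *
            (ℓ ^ 2 / ℓ ^ (d + n) * F) := by gcongr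
      _ = 4 ^ p * c * (F * ϑ * (ℓ ^ 2 / ℓ ^ (d + n))) := by
          rw [hϑ]
          ring

/-- **The printed, `L`-independent form for `d + |a| ≥ 3`** (Slade: "`c_Γ` … is independent of `L`
for `d > 2`"; with gradients the relevant exponent is `d + |a|`): since
`F_{d+n}(L) ≤ 2^{d+n-2}`, there is `c` with
`|∇^lΓ_j(x)(s)| ≤ c·(1/(2d+s))(1+L^{2(j-1)}s/(2d+s))^{-p}·(L^{j-1})^{2-d-n}` for all `L ≥ 2`,
`s > 0`, `j ≥ 1`, `x`, unit-step lists `l` of length `n`. [cite: Slade2017, §10.1 (display (10.5), "independent of L for d > 2")] [cite: BauerschmidtBrydgesSlade2019RG, Ch. 3, Proposition "Covariance decomposition" (scaling estimates, d > 2)] -/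
theorem abs_latGrad_Gam_le_of_three_le (hd : 1 ≤ d) (n p : ℕ) (hdn : 3 ≤ d + n) :
    ∃ c : ℝ, 0 < c ∧ ∀ l : List (Site d), l.length = n → (∀ e ∈ l, (∑ i, |((e i : ℤ) : ℝ)|) ≤ 1) →
      ∀ L : ℝ, 2 ≤ L → ∀ s : ℝ, 0 < s → ∀ j : ℕ, 1 ≤ j → ∀ x : Site d,
      |latGrad l (Gam d L s j) x| ≤
        c * (1 / (2 * d + s) * ((1 + (L ^ (j - 1)) ^ 2 * s / (2 * d + s)) ^ p)⁻¹) *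
          ((L ^ (j - 1)) ^ 2 / (L ^ (j - 1)) ^ (d + n)) := by
  obtain ⟨c, hc, h⟩ := abs_latGrad_Gam_le hd n p
  obtain ⟨B, hB, hF⟩ : ∃ B : ℝ, 0 < B ∧ ∀ L : ℝ, 1 ≤ L →
      ∫ τ in Ioc (1 / 2 : ℝ) (L / 2), τ / τ ^ (d + n) ≤ B :=
    ⟨_, by positivity, fun L hL => scaleIntegral_le (d := d + n) hdn hL⟩
  refine ⟨c * B, by positivity, fun l hl hl1 L hL s hs j hj x => ?_⟩
  have h1 := h l hl hl1 L hL s hs j hj x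
  have hL1 : (1 : ℝ) ≤ L := by linarith
  have hϑ : 0 ≤ (1 / (2 * d + s) * ((1 + (L ^ (j - 1)) ^ 2 * s / (2 * d + s)) ^ p)⁻¹) *
      ((L ^ (j - 1)) ^ 2 / (L ^ (j - 1)) ^ (d + n)) := by positivity
  calc |latGrad l (Gam d L s j) x|
      ≤ c * (∫ τ in Ioc (1 / 2 : ℝ) (L / 2), τ / τ ^ (d + n)) *
        (1 / (2 * d + s) * ((1 + (L ^ (j - 1)) ^ 2 * s / (2 * d + s)) ^ p)⁻¹) *
          ((L ^ (j - 1)) ^ 2 / (L ^ (j - 1)) ^ (d + n)) := h1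
    _ = c * (∫ τ in Ioc (1 / 2 : ℝ) (L / 2), τ / τ ^ (d + n)) *
        ((1 / (2 * d + s) * ((1 + (L ^ (j - 1)) ^ 2 * s / (2 * d + s)) ^ p)⁻¹) *
          ((L ^ (j - 1)) ^ 2 / (L ^ (j - 1)) ^ (d + n))) := by ring
    _ ≤ c * B * ((1 / (2 * d + s) * ((1 + (L ^ (j - 1)) ^ 2 * s / (2 * d + s)) ^ p)⁻¹) *
          ((L ^ (j - 1)) ^ 2 / (L ^ (j - 1)) ^ (d + n))) := by
        refine mul_le_mul_of_nonneg_right ?_ hϑ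
        exact mul_le_mul_of_nonneg_left (hF L hL1) hc.le
    _ = _ := by ring

end FRD

end LongRangePhi4

end Literature.Barriers.CriticalPhenomena
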